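import Mathlib.GroupTheory.PushoutI
import Mathlib.GroupTheory.ResiduallyFinite
import Mathlib.Data.ZMod.Basic
import Mathlib.Algebra.Order.BigOperators.GroupWithZero.Finset
import Mathlib.Algebra.BigOperators.Group.Finset.Piecewise
import Literature.GroupTheory.CombinatorialGroupTheory.FiniteAmalgamResiduallyFinite
import Literature.GroupTheory.CombinatorialGroupTheory.FreeGroupQuotientOrders
import HarnessLib

/-!
# Baumslag's theorem: free products of free groups with cyclic amalgamation are residually finite

Topic `Literature/GroupTheory/CombinatorialGroupTheory`; theorems only.  Let `G i = F(α i)`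
(`i` in a finite nonempty index type, each `α i` finite) be free groups of finite rank and
`φ i : ℤ →* G i` INJECTIVE homomorphisms (`n ↦ c_i ^ n`, `c_i ≠ 1`).  Then the amalgamated free
product `∗_ℤ G i = Monoid.PushoutI φ` is residually finite
(`pushoutI_freeGroup_int_residuallyFinite`) — G. Baumslag, *On the residual finiteness of
generalised free products of nilpotent groups*, Trans. AMS 106 (1963) 193–209 (the case of two
free factors with a cyclic amalgamated subgroup).  With the van Kampen decomposition
`S_g = F_{2k} *_ℤ F_{2(g-k)}` this yields the residual finiteness of surface groups
(`Literature/Topology/FourManifolds/SurfaceGroupResiduallyFinite.lean`).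

## Proof

Let `γ ≠ 1` with normal form `γ = c^e · g₁ ⋯ gₙ` (Mathlib `Monoid.PushoutI.NormalWord`: `e ∈ ℤ`,
letters `g_j ∈ G i_j` in a transversal of `⟨c_{i_j}⟩`, hence outside `⟨c_{i_j}⟩`, consecutive
indices distinct).  By ORDER CONTROL WITH SEPARATION (`exists_normal_finiteIndex_zpow_mem_iff`,
from M. Hall's theorem) there are a common integer `L > |e|` and normal finite-index subgroups
`N i ◁ G i` such that `c_i` has order exactly `L` modulo `N i` and every letter `g_j` stays outside
`⟨c_{i_j}⟩ N i_j`.  Then `ℤ/L` embeds in each finite quotient `G i / N i`, the quotient maps induce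
`Π : ∗_ℤ G i → ∗_{ℤ/L} (G i / N i)`, and `Π γ = c̄^e · ḡ₁ ⋯ ḡₙ` is again a normal form with the
same length: nonempty reduced words are not in the base group
(`Monoid.PushoutI.Reduced.eq_empty_of_mem_range`) and `c̄ ^ e ≠ 1` as `L ∤ e` when `n = 0`.  So
`Π γ ≠ 1`, and the finite amalgam `∗_{ℤ/L} (G i / N i)` is residually finite
(`pushoutI_residuallyFinite`).

## References

* G. Baumslag, *On the residual finiteness of generalised free products of nilpotent groups*,
  Trans. Amer. Math. Soc. 106 (1963) 193–209. [Baumslag1963]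
* D. E. Cohen, *Combinatorial Group Theory: a topological approach*, LMS Student Texts 14 (1989),
  Ch. 1 (amalgams of finite groups). [CohenCGT1989]
-/

namespace Literature.GroupTheory.CombinatorialGroupTheory

open Monoid Monoid.PushoutI Function

universe u v w

/-- A letter of a transversal of `range φ` different from `1` is not in `range φ`.
[cite: Baumslag1963, §4] -/
theorem not_mem_range_of_mem_transversal {ι : Type u} {G : ι → Type v} [∀ i, Group (G i)]
    {H : Type w} [Group H] {φ : ∀ i, H →* G i} (d : NormalWord.Transversal φ) {i : ι} {g : G i}
    (hg : g ∈ d.set i) (hg1 : g ≠ 1) : g ∉ (φ i).range := by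
  intro hgr
  apply hg1
  have h := (d.compl i).1
    (a₁ := (⟨g, hgr⟩, ⟨1, d.one_mem i⟩)) (a₂ := (⟨1, (φ i).range.one_mem⟩, ⟨g, hg⟩))
    (by simp)
  have := congrArg (fun p => (p.1 : G i)) h
  simpa using this

/-- Mapping a word of the free product letterwise along homomorphisms that kill none of its
letters gives a word with the same indices whose product is the image of the product.
[cite: Baumslag1963, §4] -/
theorem exists_word_map {ι : Type u} {G : ι → Type v} [∀ i, Group (G i)] {G' : ι → Type w}
    [∀ i, Group (G' i)] (f : ∀ i, G i →* G' i) (w : CoprodI.Word G)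
    (hw : ∀ l ∈ w.toList, f l.1 l.2 ≠ 1) :
    ∃ w' : CoprodI.Word G', w'.toList = w.toList.map (fun l => ⟨l.1, f l.1 l.2⟩) ∧
      w'.prod = CoprodI.lift (fun i => CoprodI.of.comp (f i)) w.prod := by
  refine ⟨⟨w.toList.map (fun l => ⟨l.1, f l.1 l.2⟩), ?_, ?_⟩, rfl, ?_⟩
  · intro l hl
    obtain ⟨l₀, hl₀, rfl⟩ := List.mem_map.mp hl
    exact hw l₀ hl₀
  · exact (List.isChain_map _).mpr w.chain_ne
  · simp only [CoprodI.Word.prod, map_list_prod, List.map_map]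
    exact congrArg List.prod (List.map_congr_left fun l _ => by simp [CoprodI.lift_of])

variable {ι : Type u} {α : ι → Type v}

/-- **Baumslag's theorem** (free factors, cyclic amalgamation).  For finitely many free groups
`F(α i)` of finite rank (`ι` nonempty) and injective `φ i : ℤ →* F(α i)`, the amalgamated free
product `∗_ℤ F(α i) = Monoid.PushoutI φ` is residually finite. [cite: Baumslag1963, Theorem 1] -/
theorem pushoutI_freeGroup_int_residuallyFinite [Finite ι] [Nonempty ι] [∀ i, Finite (α i)]
    (φ : ∀ i, Multiplicative ℤ →* FreeGroup (α i)) (hφ : ∀ i, Injective (φ i)) :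
    Group.ResiduallyFinite (PushoutI φ) := by
  classical
  haveI : Fintype ι := Fintype.ofFinite ι
  obtain ⟨d⟩ := NormalWord.transversal_nonempty φ hφ
  refine Group.residuallyFinite_of_forall_exists_finite_monoidHom fun γ hγ => ?_
  -- normal form of `γ`
  let w : NormalWord d := NormalWord.equiv γ
  have hwγ : w.prod = γ := (NormalWord.equiv (d := d)).symm_apply_apply γ
  let e : ℤ := Multiplicative.toAdd w.head
  -- the generators `c i` of the amalgamated cyclic subgroups
  let c : ∀ i, FreeGroup (α i) := fun i => φ i (Multiplicative.ofAdd 1)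
  have hφc : ∀ (i) (n : ℤ), φ i (Multiplicative.ofAdd n) = c i ^ n := by
    intro i n
    have : Multiplicative.ofAdd n = (Multiplicative.ofAdd (1 : ℤ)) ^ n := by
      rw [← ofAdd_zsmul, smul_eq_mul, mul_one]
    rw [this, map_zpow]
  have hrange : ∀ i, ((φ i).range : Set (FreeGroup (α i))) = Subgroup.zpowers (c i) := by
    intro i
    ext x
    simp only [SetLike.mem_coe, MonoidHom.mem_range, Subgroup.mem_zpowers_iff]
    constructor
    · rintro ⟨n, rfl⟩; exact ⟨Multiplicative.toAdd n, by rw [← hφc]; rfl⟩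
    · rintro ⟨n, rfl⟩; exact ⟨Multiplicative.ofAdd n, hφc i n⟩
  have hc : ∀ i, c i ≠ 1 := by
    intro i h
    have h2 : φ i (Multiplicative.ofAdd 1) = φ i (Multiplicative.ofAdd 0) := by
      rw [show (Multiplicative.ofAdd (0 : ℤ)) = 1 from rfl, (φ i).map_one]; exact h
    exact one_ne_zero (Multiplicative.ofAdd.injective (hφ i h2))
  -- the letters of `w` in the factor `i`, a finite set disjoint from `⟨c i⟩`
  let A : ∀ i, Set (FreeGroup (α i)) := fun i => {g | (⟨i, g⟩ : Σ i, FreeGroup (α i)) ∈ w.toList}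
  have hAfin : ∀ i, (A i).Finite := by
    intro i
    refine Set.Finite.subset ((w.toList.map fun l : (Σ i, FreeGroup (α i)) =>
      if h : l.1 = i then (h ▸ l.2 : FreeGroup (α i)) else 1).finite_toSet) ?_
    intro g hg
    refine List.mem_map.mpr ⟨⟨i, g⟩, hg, by simp⟩
  have hAc : ∀ i, Disjoint ((Subgroup.zpowers (c i) : Subgroup _) : Set (FreeGroup (α i))) (A i) := by
    intro i
    rw [← hrange]
    refine Set.disjoint_left.mpr fun g hgr hgA => ?_
    have hg1 : g ≠ 1 := w.ne_one ⟨i, g⟩ hgA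
    exact not_mem_range_of_mem_transversal d (w.normalized i g hgA) hg1 hgr
  -- order control with separation in each factor
  have hoc := fun i => exists_normal_finiteIndex_zpow_mem_iff (c i) (hc i) (A i) (hAfin i) (hAc i)
  choose m₀ hm₀ hN using hoc
  -- a common order `L > |e|`
  let L : ℕ := (∏ i, m₀ i) * (e.natAbs + 1)
  have hLi : ∀ i, ∃ t, 0 < t ∧ L = m₀ i * t := by
    intro i
    obtain ⟨r, hr⟩ := Finset.dvd_prod_of_mem m₀ (Finset.mem_univ i)
    refine ⟨r * (e.natAbs + 1), ?_, by show (∏ i, m₀ i) * (e.natAbs + 1) = _; rw [hr]; ring⟩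
    refine Nat.mul_pos (Nat.pos_of_ne_zero fun h => ?_) (Nat.succ_pos _)
    have : (∏ i, m₀ i) = 0 := by rw [hr, h, mul_zero]
    exact (Finset.prod_pos fun i _ => hm₀ i).ne' this
  have hLpos : 0 < L := Nat.mul_pos (Finset.prod_pos fun i _ => hm₀ i) (Nat.succ_pos _)
  have hLe : ¬ ((L : ℤ) ∣ e) ∨ e = 0 := by
    by_cases he : e = 0
    · exact Or.inr he
    · refine Or.inl fun hdvd => ?_
      have h1 : L ≤ e.natAbs := Nat.le_of_dvd (Int.natAbs_pos.mpr he) (Int.natCast_dvd.mp hdvd)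
      have h2 : e.natAbs + 1 ≤ L := Nat.le_mul_of_pos_left _ (Finset.prod_pos fun i _ => hm₀ i)
      omega
  choose t ht hLt using hLi
  have hN' := fun i => hN i (t i) (ht i)
  choose N hNn hNf hNc hNA using hN'
  have hNc' : ∀ (i) (j : ℤ), c i ^ j ∈ N i ↔ (L : ℤ) ∣ j := by
    intro i j; rw [hNc, hLt i]
  -- the finite quotients and the embedded cyclic group `ℤ/L`
  haveI : NeZero L := ⟨hLpos.ne'⟩
  let Gq : ι → Type v := fun i => FreeGroup (α i) ⧸ N i
  haveI : ∀ i, (N i).Normal := hNn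
  let π : ∀ i, FreeGroup (α i) →* Gq i := fun i => QuotientGroup.mk' (N i)
  haveI : ∀ i, Finite (Gq i) := fun i =>
    haveI := hNf i; Subgroup.finite_quotient_of_finiteIndex
  let f : ∀ i, ℤ →+ Additive (Gq i) := fun i =>
    AddMonoidHom.toMultiplicativeLeft.symm ((π i).comp (φ i))
  have hf : ∀ (i) (n : ℤ), f i n = Additive.ofMul (π i (c i ^ n)) := by
    intro i n
    change Additive.ofMul (π i (φ i (Multiplicative.ofAdd n))) = _
    rw [hφc]
  have hfL : ∀ i, f i L = 0 := by
    intro i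
    rw [hf]
    have : π i (c i ^ (L : ℤ)) = 1 := (QuotientGroup.eq_one_iff _).mpr ((hNc' i L).mpr (dvd_refl _))
    rw [this]; rfl
  let φq : ∀ i, Multiplicative (ZMod L) →* Gq i := fun i =>
    AddMonoidHom.toMultiplicativeLeft (ZMod.lift L ⟨f i, hfL i⟩)
  have hφq : ∀ (i) (n : ℤ), φq i (Multiplicative.ofAdd (n : ZMod L)) = π i (c i ^ n) := by
    intro i n
    change Additive.toMul (ZMod.lift L ⟨f i, hfL i⟩ (n : ZMod L)) = _
    rw [ZMod.lift_coe]
    change Additive.toMul (f i n) = _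
    rw [hf]; rfl
  have hφq_inj : ∀ i, Injective (φq i) := by
    intro i
    rw [← MonoidHom.ker_eq_bot_iff, Subgroup.eq_bot_iff_forall]
    intro x hx
    obtain ⟨n, hn⟩ := ZMod.intCast_surjective (Multiplicative.toAdd x)
    have hx' : x = Multiplicative.ofAdd (n : ZMod L) := by rw [hn]; rfl
    rw [MonoidHom.mem_ker, hx', hφq] at hx
    have hx2 : (L : ℤ) ∣ n := (hNc' i n).mp ((QuotientGroup.eq_one_iff _).mp hx)
    rw [hx', (ZMod.intCast_zmod_eq_zero_iff_dvd n L).mpr hx2]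
    rfl
  -- the induced map of amalgams
  let q : Multiplicative ℤ →* Multiplicative (ZMod L) :=
    AddMonoidHom.toMultiplicative (Int.castAddHom (ZMod L))
  have hq : ∀ n : ℤ, q (Multiplicative.ofAdd n) = Multiplicative.ofAdd (n : ZMod L) := fun _ => rfl
  let Pmap : PushoutI φ →* PushoutI φq :=
    PushoutI.lift (fun i => (of i).comp (π i)) ((base φq).comp q) fun i => by
      refine MonoidHom.ext_mint ?_
      simp only [MonoidHom.comp_apply]
      rw [hφc, hq, ← hφq, of_apply_eq_base]
  haveI hrf : Group.ResiduallyFinite (PushoutI φq) := pushoutI_residuallyFinite hφq_inj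
  have hPof : Pmap.comp (ofCoprodI (φ := φ)) = (ofCoprodI (φ := φq)).comp (CoprodI.lift fun i => CoprodI.of.comp (π i)) := by
    refine CoprodI.ext_hom _ _ fun i => MonoidHom.ext fun g => ?_
    simp only [MonoidHom.comp_apply, ofCoprodI_of, CoprodI.lift_of]
    exact PushoutI.lift_of _ _ _ _
  -- `Pmap γ ≠ 1`
  have hPγ : Pmap γ ≠ 1 := by
    -- the image word
    obtain ⟨w', hw'list, hw'prod⟩ := exists_word_map (fun i => π i) w.toWord (by
      rintro ⟨i, g⟩ hl h1
      have hgN : g ∈ N i := (QuotientGroup.eq_one_iff g).mp h1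
      have hgA : g ∈ A i := hl
      exact Set.disjoint_left.mp (hNA i) (Subgroup.mem_sup_right hgN) hgA)
    have hletters : ∀ l ∈ w'.toList, ∀ n : ℤ,
        φq l.1 (Multiplicative.ofAdd (n : ZMod L)) ≠ l.2 := by
      intro l hl n hEq
      rw [hw'list] at hl
      obtain ⟨l₀, hl₀, rfl⟩ := List.mem_map.mp hl
      obtain ⟨i, g⟩ := l₀
      -- `π i (c i ^ n) = π i g`, so `g ∈ ⟨c i⟩ N i`, contradicting separation
      dsimp only at hEq
      rw [hφq] at hEq
      have h1 : (c i ^ n)⁻¹ * g ∈ N i := (QuotientGroup.eq (s := N i)).mp hEq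
      have h2 : g ∈ Subgroup.zpowers (c i) ⊔ N i := by
        have : g = c i ^ n * ((c i ^ n)⁻¹ * g) := by group
        rw [this]
        exact Subgroup.mul_mem_sup ((Subgroup.zpowers (c i)).zpow_mem (Subgroup.mem_zpowers _) n) h1
      exact Set.disjoint_left.mp (hNA i) h2 hl₀
    have hw'red : Reduced φq w' := by
      rintro l hl ⟨z, hz⟩
      obtain ⟨n, hn⟩ := ZMod.intCast_surjective (Multiplicative.toAdd z)
      have hz' : z = Multiplicative.ofAdd (n : ZMod L) := by rw [hn]; rfl
      rw [hz'] at hz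
      exact hletters l hl n hz
    have hP : Pmap γ = base φq (q w.head) * ofCoprodI (φ := φq) w'.prod := by
      rw [← hwγ, NormalWord.prod, map_mul, PushoutI.lift_base, MonoidHom.comp_apply, hw'prod,
        ← MonoidHom.comp_apply (ofCoprodI (φ := φq)), ← hPof, MonoidHom.comp_apply]
    intro h1
    rw [hP] at h1
    have h2 : ofCoprodI (φ := φq) w'.prod ∈ (base φq).range := by
      refine ⟨(q w.head)⁻¹, ?_⟩
      rw [map_inv]
      exact (eq_inv_of_mul_eq_one_right h1).symm
    have h3 : w' = .empty := Reduced.eq_empty_of_mem_range hφq_inj hw'red h2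
    have h4 : w.toList = [] := by
      have := congrArg CoprodI.Word.toList h3
      rw [hw'list, CoprodI.Word.empty_toList, List.map_eq_nil_iff] at this
      exact this
    have h5 : ofCoprodI (φ := φq) w'.prod = 1 := by rw [h3, CoprodI.Word.prod_empty, map_one]
    rw [h5, mul_one] at h1
    have h6 : q w.head = 1 := base_injective hφq_inj (by rw [h1, map_one])
    have h7 : e = 0 := by
      have h8 : ((e : ℤ) : ZMod L) = 0 := by
        have := congrArg Multiplicative.toAdd h6
        exact this
      rcases hLe with h9 | h9
      · exact absurd ((ZMod.intCast_zmod_eq_zero_iff_dvd e L).mp h8) h9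
      · exact h9
    apply hγ
    rw [← hwγ, NormalWord.prod]
    have h10 : w.head = 1 := by
      change Multiplicative.toAdd w.head = 0 at h7
      exact Multiplicative.toAdd.injective h7
    have h11 : w.toWord.prod = 1 := by
      rw [CoprodI.Word.prod, h4, List.map_nil, List.prod_nil]
    rw [h10, h11, map_one, map_one, mul_one]
  obtain ⟨K, hK⟩ := Group.exists_finiteIndexNormalSubgroup_notMem (Pmap γ) hPγ
  haveI := K.toSubgroup.finite_quotient_of_finiteIndex
  refine ⟨PushoutI φq ⧸ K.toSubgroup, inferInstance, inferInstance,
    (QuotientGroup.mk' K.toSubgroup).comp Pmap, ?_⟩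
  rw [MonoidHom.comp_apply, QuotientGroup.mk'_apply, ne_eq, QuotientGroup.eq_one_iff]
  exact hK

end Literature.GroupTheory.CombinatorialGroupTheory
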